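import Summits.NavierStokesRegularity.FunctionalMining.NoGo.TopBotEigSplitShareWindow
import Summits.NavierStokesRegularity.FunctionalMining.NoGo.TopBotEigSplitWallSides
import HarnessLib

/-!
search for candidate a priori estimates; no regularity claim

# K21 — `q = 3`: the sharp share `c_axi(3) = (5√6 − √22)/24` is ATTAINED; the `q = 3` share
# window is `Iic (c_axi 3)` — the first odd exponent (door D-K6 (c))

K16 proved the NECESSITY `TopBotEigSplitting q c → c ≤ cAxi q` for every real `q > 1` and the
closed form `cAxi_three : cAxi 3 = (5√6 − √22)/24`; K19 reduced the SUFFICIENCY at `c = cAxi q`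
to three sign conditions (N⁺)(D)(W) of explicit one-variable closed forms on `[1/3, 2/3]`; K20b
packaged the window.  This file DISCHARGES (N⁺)(D)(W) at `q = 3` in the kernel:

* §1 the `q = 3` closed forms are functions of `s = lineNsq u = 6u² − 6u + 2 ∈ [1/2, 2/3]` and
  `√s` alone: `u³ + (1−u)³ = s/2`, `(2u−1)² = (2s−1)/3`, hence
  `lineN_three  : N  = s/2 − c·s·√s`,
  `lineN1_three : N′ = 3(2u−1)(1 − 3c√s)`,
  `lineN2_three : N″ = 6 − c(9(2s−1)/√s + 18√s)`,
  `lineT_three  : T  = (27c² − 3)·s − (45/2)·c·√s + 6` — `T` is an explicit quadratic in `√s`;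
* §2 at `c = cAxi 3`: `cAxi_three_lt_third : cAxi 3 < 1/3` (so `27c² − 3 < 0`), the WALL IDENTITY
  `lineT_three_wall : (27c² − 3)·(2/3) − (45/2)·c·√(2/3) + 6 = 0` (K16ʼs wall equation in closed
  form, from `√6² = 6`, `√22² = 22` by `linear_combination`), and — since the quadratic
  `ρ ↦ (27c² − 3)ρ² − (45c/2)ρ + 6` is strictly decreasing on `ρ > 0` and vanishes at `ρ = √(2/3)` —
  (W) `lineT_three_nonneg : 0 ≤ lineT 3 (cAxi 3) u` on `(1/3, 2/3)` (there `s < 2/3`);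
  (N⁺) `lineN_three_pos` (`c√s < 1/2`) and (D) `lineD_three` (`c√s ≤ 5/18` and
  `(5/18)(3u−1) ≤ u²`) on `[1/3, 2/3]`;
* §3 **`topBotEigSplitting_three_isGreatest : IsGreatest {c | TopBotEigSplitting 3 c} (cAxi 3)`**
  (K20b `topBotEigSplitting_isGreatest_of_line`), **`topBotEigSplitting_three_sharp :
  TopBotEigSplitting 3 (cAxi 3)`**, `topBotEigSplitting_three_sharp_explicit :
  TopBotEigSplitting 3 ((5√6 − √22)/24)`, **`topBotEigSplitting_three_window :
  {c | TopBotEigSplitting 3 c} = Iic (cAxi 3)`**, `topBotEigSplitting_three_iff`,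
  `sSup_topBotEigSplitting_three = cAxi 3`.

So `c*(3) = c_axi(3) = (5√6 − √22)/24 ≈ 0.31488` is ATTAINED and the `q = 3` share question of
door (c) is closed in full, like `q = 2` (`1/3`, K20b) and `q = 4` (`2/9`, K14/K17/K20b).
Credit: the shape of §1–§2 (everything a function of `s`, `T` affine in `s` and `√s`, monotone in
`√s`, zero at the wall) was READ numerically / in exact field arithmetic by census-1 ((cc.212),
a reading, not a verdict); every identity and inequality here is RE-DERIVED in the kernel and
nothing is cited.  All algebra [ours, elementary]; Mathlib: `Real.rpow_ofNat`, `Real.rpow_add`,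
`Real.rpow_neg`, `Real.sqrt_eq_rpow`, `Real.sq_sqrt`, `Real.sqrt_lt_sqrt`, `Real.sqrt_lt'`,
`Real.lt_sqrt`, `linear_combination`, `nlinarith`.

NOT claimed: (N⁺)/(D)/(W) for any `q ∉ {2, 3, 4}`; nothing on `heatDissipation`,
`TopEigHeatCoercivePos`, `NegBotEigHeatCoercivePos`; the verdict of record L-λ(q) stays OPEN (kernel)
for every real `q > 1`.

Imports: the no-go seatʼs staged K20b `NoGo.TopBotEigSplitShareWindow` (which imports staged K20a,
K19 and K16 part 2) and staged K25 `NoGo.TopBotEigSplitWallSides` (for the bookkeeping `lineNsq_le_two_thirds`, cited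
by name).  Zero sorries, no new axioms.
v2 = v1 84340a177cc2d552 with the local copy of `lineNsq_le_two_thirds` DELETED and K25 `NoGo.TopBotEigSplitWallSides` imported
instead (same fq name AND statement there; K25 lands first — census-1 (cc.265) T4); the two uses resolve to K25's lemma; nothing else
changed (K22/K23, which import this file, use the same name and are byte-unchanged).
FILING (prove seat g28, REQUEST #37): declarations byte-identical to the no-go seat's staged `TopBotEigSplitSharpThree.STAGING.lean` 8d371efdeed7895a; this line is the only addition.
-/

noncomputable section

open Real Set

namespace Summit.NavierStokesRegularity.FunctionalMining.TopEig

/-! ## 1. The `q = 3` closed forms as functions of `s = lineNsq u` and `√s` -/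

section forms

/-- `u³ + (1−u)³ = s/2`. [bookkeeping] -/
theorem cube_add_cube_lineNsq (u : ℝ) : u ^ 3 + (1 - u) ^ 3 = lineNsq u / 2 := by
  unfold lineNsq; ring

/-- `(2u−1)² = (2s−1)/3`. [bookkeeping] -/
theorem sq_two_mul_sub_one_lineNsq (u : ℝ) : (2 * u - 1) ^ 2 = (2 * lineNsq u - 1) / 3 := by
  unfold lineNsq; ring

/-- `s < 2/3` on the open interval `(1/3, 2/3)`. [bookkeeping] -/
theorem lineNsq_lt_two_thirds {u : ℝ} (h1 : 1 / 3 < u) (h2 : u < 2 / 3) : lineNsq u < 2 / 3 := by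
  unfold lineNsq; nlinarith

/-- `√s > 0`. [bookkeeping] -/
theorem sqrt_lineNsq_pos (u : ℝ) : 0 < Real.sqrt (lineNsq u) := Real.sqrt_pos.mpr (lineNsq_pos u)

/-- `s^{1/2} = √s`. [bookkeeping] -/
theorem rpow_half_lineNsq (u : ℝ) : lineNsq u ^ ((1 : ℝ) / 2) = Real.sqrt (lineNsq u) :=
  (Real.sqrt_eq_rpow _).symm

/-- `N = s/2 − c·s·√s` at `q = 3`. [ours, by value] -/
theorem lineN_three (c u : ℝ) :
    lineN 3 c u = lineNsq u / 2 - c * (lineNsq u * Real.sqrt (lineNsq u)) := by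
  have h32 : lineNsq u ^ ((3 : ℝ) / 2) = lineNsq u * Real.sqrt (lineNsq u) := by
    rw [show (3 : ℝ) / 2 = 1 + 1 / 2 by norm_num, Real.rpow_add (lineNsq_pos u), Real.rpow_one,
      rpow_half_lineNsq]
  unfold lineN; rw [h32]; simp only [Real.rpow_ofNat]; linarith [cube_add_cube_lineNsq u]

/-- `N′ = 3(2u−1)(1 − 3c√s)` at `q = 3`. [ours, by value] -/
theorem lineN1_three (c u : ℝ) :
    lineN1 3 c u = 3 * (2 * u - 1) * (1 - 3 * c * Real.sqrt (lineNsq u)) := by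
  unfold lineN1
  rw [show (3 : ℝ) - 1 = 2 by norm_num, show (3 : ℝ) / 2 - 1 = 1 / 2 by norm_num, rpow_half_lineNsq]
  simp only [Real.rpow_two]; ring

/-- `N″ = 6 − c(9(2s−1)/√s + 18√s)` at `q = 3` (uses `(12u−6)² = 12(2s−1)`). [ours, by value] -/
theorem lineN2_three (c u : ℝ) :
    lineN2 3 c u =
      6 - c * (9 * (2 * lineNsq u - 1) / Real.sqrt (lineNsq u) + 18 * Real.sqrt (lineNsq u)) := by
  unfold lineN2
  rw [show (3 : ℝ) - 2 = 1 by norm_num, show (3 : ℝ) / 2 - 2 = -(1 / 2) by norm_num,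
    show (3 : ℝ) / 2 - 1 = 1 / 2 by norm_num, Real.rpow_neg (lineNsq_pos u).le, rpow_half_lineNsq]
  simp only [Real.rpow_one]
  unfold lineNsq; ring

/-- **`T = (27c² − 3)·s − (45/2)·c·√s + 6` at `q = 3`** — an explicit quadratic in `√s`.
[ours, by value] -/
theorem lineT_three (c u : ℝ) :
    lineT 3 c u = (27 * c ^ 2 - 3) * lineNsq u - 45 / 2 * c * Real.sqrt (lineNsq u) + 6 := by
  have hρ := sqrt_lineNsq_pos u
  have hρ2 : Real.sqrt (lineNsq u) ^ 2 = lineNsq u := Real.sq_sqrt (lineNsq_pos u).le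
  have h1sq : lineN1 3 c u ^ 2 =
      3 * (2 * lineNsq u - 1) * (1 - 3 * c * Real.sqrt (lineNsq u)) ^ 2 := by
    rw [lineN1_three, mul_pow, mul_pow, sq_two_mul_sub_one_lineNsq]; ring
  have key : ∀ s ρ : ℝ, 0 < ρ → ρ ^ 2 = s →
      3 * (s / 2 - c * (s * ρ)) * (6 - c * (9 * (2 * s - 1) / ρ + 18 * ρ)) -
          (3 - 1) * (3 * (2 * s - 1) * (1 - 3 * c * ρ) ^ 2) =
        (27 * c ^ 2 - 3) * s - 45 / 2 * c * ρ + 6 := by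
    intro s ρ hρ h; subst h; field_simp; ring
  unfold lineT; rw [h1sq, lineN_three, lineN2_three]
  linarith [key _ _ hρ hρ2]

end forms

/-! ## 2. (N⁺)(D)(W) at `c = c_axi(3)` -/

section signs

/-- `c_axi(3) < 1/3`. [ours, by value] -/
theorem cAxi_three_lt_third : cAxi 3 < 1 / 3 := by
  rw [cAxi_three]
  have h6 : Real.sqrt 6 < 49 / 20 := by
    rw [Real.sqrt_lt' (by norm_num)]; norm_num
  have h22 : (469 : ℝ) / 100 < Real.sqrt 22 := by
    rw [Real.lt_sqrt (by norm_num)]; norm_num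
  linarith

/-- `√(2/3) = √6/3`. [bookkeeping] -/
theorem sqrt_two_thirds : Real.sqrt (2 / 3) = Real.sqrt 6 / 3 := by
  rw [show (2 : ℝ) / 3 = (Real.sqrt 6 / 3) ^ 2 by
    rw [div_pow, Real.sq_sqrt (by norm_num : (0 : ℝ) ≤ 6)]; norm_num]
  exact Real.sqrt_sq (by positivity)

/-- **The wall identity at `q = 3`**: the quadratic `(27c² − 3)ρ² − (45c/2)ρ + 6` vanishes at
`ρ = √(2/3)` for `c = c_axi(3) = (5√6 − √22)/24` (K16ʼs wall equation in closed form).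
[ours, by value] -/
theorem lineT_three_wall :
    (27 * cAxi 3 ^ 2 - 3) * (2 / 3) - 45 / 2 * cAxi 3 * Real.sqrt (2 / 3) + 6 = 0 := by
  rw [cAxi_three, sqrt_two_thirds]
  have h6 : Real.sqrt 6 ^ 2 = 6 := Real.sq_sqrt (by norm_num)
  have h22 : Real.sqrt 22 ^ 2 = 22 := Real.sq_sqrt (by norm_num)
  linear_combination (-(25 : ℝ) / 32) * h6 + (1 / 32 : ℝ) * h22

/-- `T` vanishes at both endpoints `u = 1/3`, `u = 2/3` (where `s = 2/3`). [ours, by value] -/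
theorem lineT_three_endpoints : lineT 3 (cAxi 3) (1 / 3) = 0 ∧ lineT 3 (cAxi 3) (2 / 3) = 0 := by
  rw [lineT_three, lineT_three, lineNsq_one_third, lineNsq_two_thirds]
  exact ⟨lineT_three_wall, lineT_three_wall⟩

/-- **(W) at `q = 3`**: `0 ≤ T` on `(1/3, 2/3)` — there `s < 2/3`, so `√s < √(2/3)`, and the
quadratic is strictly decreasing in `√s > 0` (`27c² − 3 < 0`, `c > 0`) with a zero at `√(2/3)`.
In fact `T > 0` inside. [ours, elementary] -/
theorem lineT_three_nonneg ⦃u : ℝ⦄ (h1 : 1 / 3 < u) (h2 : u < 2 / 3) : 0 ≤ lineT 3 (cAxi 3) u := by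
  rw [lineT_three]
  have hc := cAxi_pos (show (1 : ℝ) < 3 by norm_num)
  have hc3 := cAxi_three_lt_third
  have hκ : 27 * cAxi 3 ^ 2 - 3 < 0 := by nlinarith
  have hρ := sqrt_lineNsq_pos u
  have hρ2 : Real.sqrt (lineNsq u) ^ 2 = lineNsq u := Real.sq_sqrt (lineNsq_pos u).le
  have hρ0 : Real.sqrt (2 / 3) ^ 2 = 2 / 3 := Real.sq_sqrt (by norm_num)
  have hlt : Real.sqrt (lineNsq u) < Real.sqrt (2 / 3) :=
    Real.sqrt_lt_sqrt (lineNsq_pos u).le (lineNsq_lt_two_thirds h1 h2)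
  have hwall := lineT_three_wall
  have hfac : (27 * cAxi 3 ^ 2 - 3) * lineNsq u - 45 / 2 * cAxi 3 * Real.sqrt (lineNsq u) + 6 =
      (Real.sqrt (2 / 3) - Real.sqrt (lineNsq u)) *
        (45 / 2 * cAxi 3 - (27 * cAxi 3 ^ 2 - 3) * (Real.sqrt (lineNsq u) + Real.sqrt (2 / 3))) := by
    linear_combination (-(27 * cAxi 3 ^ 2 - 3)) * hρ2 + (27 * cAxi 3 ^ 2 - 3) * hρ0 + hwall
  rw [hfac]
  have hA : 0 < Real.sqrt (2 / 3) - Real.sqrt (lineNsq u) := sub_pos.mpr hlt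
  have hB : 0 < 45 / 2 * cAxi 3 -
      (27 * cAxi 3 ^ 2 - 3) * (Real.sqrt (lineNsq u) + Real.sqrt (2 / 3)) := by
    have : 0 < Real.sqrt (lineNsq u) + Real.sqrt (2 / 3) := by positivity
    linarith [mul_neg_of_neg_of_pos hκ this]
  positivity

/-- **(N⁺) at `q = 3`**: `N = s(1/2 − c√s) > 0` on `[1/3, 2/3]` (`c < 1/3`, `√s ≤ √(2/3) < 1`).
[ours, elementary] -/
theorem lineN_three_pos ⦃u : ℝ⦄ (h1 : 1 / 3 ≤ u) (h2 : u ≤ 2 / 3) : 0 < lineN 3 (cAxi 3) u := by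
  rw [lineN_three]
  have hs := lineNsq_pos u
  have hc := cAxi_pos (show (1 : ℝ) < 3 by norm_num)
  have hc3 := cAxi_three_lt_third
  have hρ := sqrt_lineNsq_pos u
  have hρ2 : Real.sqrt (lineNsq u) ^ 2 = lineNsq u := Real.sq_sqrt hs.le
  have hs23 := lineNsq_le_two_thirds h1 h2
  have hρ1 : Real.sqrt (lineNsq u) < 1 := by nlinarith
  have hcρ : cAxi 3 * Real.sqrt (lineNsq u) < 1 / 3 := by
    calc cAxi 3 * Real.sqrt (lineNsq u) ≤ cAxi 3 * 1 :=
          mul_le_mul_of_nonneg_left hρ1.le hc.le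
      _ < 1 / 3 := by linarith
  have : lineNsq u / 2 - cAxi 3 * (lineNsq u * Real.sqrt (lineNsq u)) =
      lineNsq u * (1 / 2 - cAxi 3 * Real.sqrt (lineNsq u)) := by ring
  rw [this]; exact mul_pos hs (by linarith)

/-- **(D) at `q = 3`**: `c(3u−1)·√s ≤ u²` on `[1/3, 2/3]` (`c√s ≤ 5/18` and
`(5/18)(3u−1) ≤ u²`, a negative-discriminant quadratic). [ours, elementary] -/
theorem lineD_three ⦃u : ℝ⦄ (h1 : 1 / 3 ≤ u) (h2 : u ≤ 2 / 3) :
    cAxi 3 * (3 * u - 1) * lineNsq u ^ ((3 : ℝ) / 2 - 1) ≤ u ^ ((3 : ℝ) - 1) := by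
  rw [show (3 : ℝ) / 2 - 1 = 1 / 2 by norm_num, show (3 : ℝ) - 1 = 2 by norm_num, rpow_half_lineNsq,
    Real.rpow_two]
  have hs := lineNsq_pos u
  have hc := cAxi_pos (show (1 : ℝ) < 3 by norm_num)
  have hc3 := cAxi_three_lt_third
  have hρ := sqrt_lineNsq_pos u
  have hρ2 : Real.sqrt (lineNsq u) ^ 2 = lineNsq u := Real.sq_sqrt hs.le
  have hs23 := lineNsq_le_two_thirds h1 h2
  have hρ56 : Real.sqrt (lineNsq u) ≤ 5 / 6 := by nlinarith
  have hcρ : cAxi 3 * Real.sqrt (lineNsq u) ≤ 5 / 18 := by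
    calc cAxi 3 * Real.sqrt (lineNsq u) ≤ 1 / 3 * Real.sqrt (lineNsq u) :=
          mul_le_mul_of_nonneg_right hc3.le hρ.le
      _ ≤ 1 / 3 * (5 / 6) := by linarith
      _ = 5 / 18 := by norm_num
  have h3u : 0 ≤ 3 * u - 1 := by linarith
  calc cAxi 3 * (3 * u - 1) * Real.sqrt (lineNsq u)
      = cAxi 3 * Real.sqrt (lineNsq u) * (3 * u - 1) := by ring
    _ ≤ 5 / 18 * (3 * u - 1) := mul_le_mul_of_nonneg_right hcρ h3u
    _ ≤ u ^ 2 := by nlinarith [sq_nonneg (u - 5 / 12)]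

end signs

/-! ## 3. `q = 3`: the sharp share is attained and the window is `Iic (c_axi 3)` -/

section window

/-- **`c_axi(3)` is the greatest `q = 3` share** (K20b `topBotEigSplitting_isGreatest_of_line` with
(N⁺)(D)(W) discharged). [ours] -/
theorem topBotEigSplitting_three_isGreatest :
    IsGreatest {c : ℝ | TopBotEigSplitting 3 c} (cAxi 3) :=
  topBotEigSplitting_isGreatest_of_line (by norm_num) lineN_three_pos lineD_three lineT_three_nonneg

/-- **`TopBotEigSplitting 3 (cAxi 3)`** — the sharp `q = 3` share is ATTAINED. [ours] -/
theorem topBotEigSplitting_three_sharp : TopBotEigSplitting 3 (cAxi 3) :=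
  topBotEigSplitting_three_isGreatest.1

/-- The same with K16ʼs closed form: `TopBotEigSplitting 3 ((5√6 − √22)/24)`. [ours] -/
theorem topBotEigSplitting_three_sharp_explicit :
    TopBotEigSplitting 3 ((5 * Real.sqrt 6 - Real.sqrt 22) / 24) :=
  cAxi_three ▸ topBotEigSplitting_three_sharp

/-- **The `q = 3` share window is exactly `(-∞, c_axi(3)]`**. [ours] -/
theorem topBotEigSplitting_three_window : {c : ℝ | TopBotEigSplitting 3 c} = Iic (cAxi 3) :=
  topBotEigSplitting_window_of_line (by norm_num) lineN_three_pos lineD_three lineT_three_nonneg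

/-- Pointwise form at `q = 3`: `TopBotEigSplitting 3 c ↔ c ≤ c_axi(3)`. [ours] -/
theorem topBotEigSplitting_three_iff (c : ℝ) : TopBotEigSplitting 3 c ↔ c ≤ cAxi 3 :=
  topBotEigSplitting_iff_le_cAxi_of_line (by norm_num) lineN_three_pos lineD_three
    lineT_three_nonneg c

/-- `sSup {c | TopBotEigSplitting 3 c} = c_axi(3)`. [ours] -/
theorem sSup_topBotEigSplitting_three : sSup {c : ℝ | TopBotEigSplitting 3 c} = cAxi 3 :=
  sSup_topBotEigSplitting_of_line (by norm_num) lineN_three_pos lineD_three lineT_three_nonneg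

/-- Numerical sanity: `0.3148 < c_axi(3) < 0.3149` (`c_axi(3) = 0.31487…`). [ours, by value] -/
theorem cAxi_three_bounds : (3148 : ℝ) / 10000 < cAxi 3 ∧ cAxi 3 < 3149 / 10000 := by
  rw [cAxi_three]
  have h6a : (2449489 : ℝ) / 1000000 < Real.sqrt 6 := by rw [Real.lt_sqrt (by norm_num)]; norm_num
  have h6b : Real.sqrt 6 < 244949 / 100000 := by rw [Real.sqrt_lt' (by norm_num)]; norm_num
  have h22a : (4690415 : ℝ) / 1000000 < Real.sqrt 22 := by rw [Real.lt_sqrt (by norm_num)]; norm_num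
  have h22b : Real.sqrt 22 < 4690416 / 1000000 := by rw [Real.sqrt_lt' (by norm_num)]; norm_num
  constructor <;> linarith

end window

end Summit.NavierStokesRegularity.FunctionalMining.TopEig

end
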